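import Mathlib.Data.Nat.ModEq
import Mathlib.Data.Int.GCD
import Mathlib.Data.Nat.Totient
import Mathlib.FieldTheory.Finite.Basic
import Mathlib.RingTheory.Coprime.Lemmas
import Mathlib.Algebra.Order.Group.Unbundled.Int
import Literature.Computability.Complexity.QuadraticCongruences
import Literature.Computability.Complexity.CRRFacts
import HarnessLib

/-!
# Manders–Adleman 1978: from a `±1` knapsack equation to one quadratic congruence (Lemmas 1 and 2)

The number-theoretic core of the NP-hardness of QUADRATIC CONGRUENCES (`QUADCONG`,
`QuadraticCongruences.lean`; Manders–Adleman, J. Comput. System Sci. 16 (1978), §2, proof of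
Thm. 2; restated in full by Jansen–Klein–Lassota, Math. Program. 197 (2022), §2, proof of Thm. 2).
The reduction turns a system "`∑ⱼ cⱼ αⱼ = τ`, `αⱼ ∈ {−1, +1}`" (a knapsack in `±1` form, `τ` odd)
into ONE congruence `x² ≡ A (mod 2^{s+1}·K)` with a bound `x ≤ H`, through the parameters

* distinct odd primes `p₀, …, p_{N-1}`, an exponent `e ≥ 1`, `K = ∏ⱼ pⱼ^e`,
  `Qⱼ = ∏_{i ≠ j} pᵢ^e`, and `θⱼ = Qⱼ·tⱼ` with `pⱼ ∤ tⱼ` and `θⱼ ≡ cⱼ (mod 2^s)`, `H = ∑ⱼ θⱼ`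
  ("`θⱼ ≡ cⱼ mod 2^s`, `θⱼ ≡ 0 mod ∏_{i≠j} pᵢ^{n+1}`, `θⱼ ≢ 0 mod pⱼ`", M–A p. 171);
* **Lemma 1** (M–A p. 178, `Sys.lemma1`): if `2H < K` then for `|x| ≤ H`,
  `K ∣ (H + x)(H − x)` iff `x = ∑ⱼ αⱼ θⱼ` for some signs `αⱼ` — each odd prime power `pⱼ^e`
  divides exactly one of `H ± x` (it cannot divide both since `pⱼ ∤ 2H`), which fixes `αⱼ`, and
  two solutions congruent mod `K` and both of modulus `≤ H` coincide;
* **Lemma 2** (M–A p. 176, `two_pow_dvd_add_or_sub`): for `τ` odd,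
  `2^{s+1} ∣ (τ + x)(τ − x)` implies `2^s ∣ τ + x` or `2^s ∣ τ − x`;
* the assembly (`Inst.main`, M–A systems (I)–(III), pp. 176–177): with
  `∑ⱼ cⱼ + |τ| < 2^s` (so that the congruence `∑ cⱼαⱼ ≡ τ (mod 2^s)` is the equation) and any
  `A ≡ τ² (mod 2^{s+1})`, `A ≡ H² (mod K)`, the `±1` system is solvable iff some natural `x ≤ H`
  has `x² ≡ A (mod 2^{s+1} K)`; and its QUADRATIC CONGRUENCES form (`Inst.main_quadCongSet`):
  iff `(A, 2^{s+1} K, H + 1) ∈ quadCongSet` (Garey–Johnson's `0 < x < c`; `x = 0` is never a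
  solution because `A` is odd).

A concrete admissible choice of `tⱼ` from `cⱼ` by one modular inverse
(`tOf`, `tOf_spec`: `t = c·Q^{2^{s-1}-1} mod 2^s`, plus `2^s` if `pⱼ` divides that) and the size
estimate `2H < K` for `e = s + N + 2` and primes `≥ 3` (`two_mul_H_lt_K`) are included; the prime
supply, the coefficients `cⱼ` of a KNAPSACK instance and the polynomial-time machine are in the
sibling files. Everything is stated over index ranges `Finset.range N` with functions `ℕ → ℕ`
(the shape produced by the counted folds of the machine).

## References

* [MandersAdleman1978] K. L. Manders, L. Adleman, *NP-complete decision problems for binary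
  quadratics*, J. Comput. System Sci. 16 (1978) 168–184, §2: the reduction (p. 171), Lemma 1 and its
  proof (p. 178), Lemma 2 (p. 176), systems (I)–(III) (pp. 176–177).
* [JansenKleinLassota2022] K. Jansen, K.-M. Klein, A. Lassota, *The double exponential runtime is
  tight for 2-stage stochastic ILPs*, Math. Program. 197 (2022), §2 (proof of Thm. 2, restating the
  Manders–Adleman argument step by step).
-/

namespace Literature.Computability.Complexity

namespace MandersAdleman

open Finset

/-! ### Signs -/

/-- The sign `±1` coded by a bit (`true ↦ 1`, `false ↦ −1`). [folklore] -/
def sgn (b : Bool) : ℤ := if b then 1 else -1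

/-- `sgn 1 = 1`. [folklore] -/
@[simp] theorem sgn_true : sgn true = 1 := rfl

/-- `sgn 0 = -1`. [folklore] -/
@[simp] theorem sgn_false : sgn false = -1 := rfl

/-- `|sgn b| = 1`. [folklore] -/
theorem abs_sgn (b : Bool) : |sgn b| = 1 := by cases b <;> simp [sgn]

/-- `sgn (!b) = - sgn b`. [folklore] -/
@[simp] theorem sgn_not (b : Bool) : sgn (!b) = -sgn b := by cases b <;> simp [sgn]

/-- `sgn b * sgn b = 1`. [folklore] -/
@[simp] theorem sgn_mul_self (b : Bool) : sgn b * sgn b = 1 := by cases b <;> simp [sgn]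

/-! ### Lemma 2: square roots of an odd square modulo a power of two -/

/-- **Manders–Adleman, Lemma 2.** For `τ` odd and any integer `x`: if `2^{s+1}` divides
`(τ + x)(τ − x)` then `2^s` divides `τ + x` or `τ − x` ("The straightforward proof is left to the
reader": both factors are even, their sum `2τ ≡ 2 (mod 4)` shows that one of them is `2·odd`, so
the other carries `2^s`). [cite: MandersAdleman1978, §2 Lemma 2 (p. 176)] -/
theorem two_pow_dvd_add_or_sub {τ x : ℤ} (hτ : Odd τ) {s : ℕ}
    (h : (2 : ℤ) ^ (s + 1) ∣ (τ + x) * (τ - x)) : (2 : ℤ) ^ s ∣ τ + x ∨ (2 : ℤ) ^ s ∣ τ - x := by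
  rcases Nat.eq_zero_or_pos s with rfl | hs
  · exact Or.inl (by simp)
  -- both factors are even
  have h2 : (2 : ℤ) ∣ (τ + x) * (τ - x) := (dvd_pow_self 2 (Nat.succ_ne_zero s)).trans h
  have hev : (2 : ℤ) ∣ τ + x := by
    rcases Int.prime_two.dvd_or_dvd h2 with h | h
    · exact h
    · have : τ + x = (τ - x) + 2 * x := by ring
      rw [this]; exact dvd_add h (dvd_mul_right 2 x)
  obtain ⟨u, hu⟩ := hev
  have hv : τ - x = 2 * (τ - u) := by linarith
  set v := τ - u with hv'
  -- `u + v = τ` is odd: one of `u`, `v` is odd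
  have huv : u + v = τ := by rw [hv']; linarith
  have h4 : (2 : ℤ) ^ (s + 1) = 4 * 2 ^ (s - 1) := by
    obtain ⟨k, rfl⟩ := Nat.exists_eq_add_of_le hs
    rw [show 1 + k + 1 = k + 2 by ring, show 1 + k - 1 = k by omega, pow_add]; ring
  rw [hu, hv, h4, show 2 * u * (2 * v) = 4 * (u * v) by ring] at h
  have h' : (2 : ℤ) ^ (s - 1) ∣ u * v := (mul_dvd_mul_iff_left (by norm_num : (4 : ℤ) ≠ 0)).1 h
  have hs' : (2 : ℤ) ^ s = 2 * 2 ^ (s - 1) := by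
    obtain ⟨k, rfl⟩ := Nat.exists_eq_add_of_le hs
    rw [show 1 + k - 1 = k by omega, pow_add, pow_one]
  rcases Int.even_or_odd u with heu | hou
  · -- `u` even forces `v` odd
    have hov : Odd v := by
      by_contra hv2
      rw [Int.not_odd_iff_even] at hv2
      exact (Int.not_even_iff_odd.2 hτ) (huv ▸ heu.add hv2)
    have hcop : IsCoprime ((2 : ℤ) ^ (s - 1)) v :=
      ((Prime.coprime_iff_not_dvd Int.prime_two).2 (by rwa [← even_iff_two_dvd, Int.not_even_iff_odd])).pow_left
    have : (2 : ℤ) ^ (s - 1) ∣ u := hcop.dvd_of_dvd_mul_right h'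
    left
    rw [hu, hs']
    exact mul_dvd_mul_left 2 this
  · have hcop : IsCoprime ((2 : ℤ) ^ (s - 1)) u :=
      ((Prime.coprime_iff_not_dvd Int.prime_two).2 (by rwa [← even_iff_two_dvd, Int.not_even_iff_odd])).pow_left
    have : (2 : ℤ) ^ (s - 1) ∣ v := hcop.dvd_of_dvd_mul_left h'
    right
    rw [hv, hs']
    exact mul_dvd_mul_left 2 this

/-! ### Lemma 1: the system `|x| ≤ H`, `K ∣ (H + x)(H − x)` -/

/-- **The data of the Chinese-remainder encoding** (Manders–Adleman p. 171, in the pared-down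
form of their Comment (1), p. 179): `N` indices, an exponent `e ≥ 1`, bases `p₀, …, p_{N-1}` that
are pairwise distinct odd primes, and multipliers `tⱼ` with `pⱼ ∤ tⱼ`; from these
`K = ∏ pⱼ^e`, `Qⱼ = ∏_{i≠j} pᵢ^e`, `θⱼ = Qⱼ tⱼ` (so `θⱼ ≡ 0 mod ∏_{i≠j} pᵢ^e`, `θⱼ ≢ 0 mod pⱼ`)
and `H = ∑ θⱼ`. [cite: MandersAdleman1978, §2 (reduction, p. 171; Comment (1), p. 179)] -/
structure Sys where
  /-- number of indices `j = 0, …, N - 1` -/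
  N : ℕ
  /-- the common exponent of the prime powers -/
  e : ℕ
  /-- the bases -/
  p : ℕ → ℕ
  /-- the multipliers -/
  t : ℕ → ℕ
  prime : ∀ j < N, (p j).Prime
  two_lt : ∀ j < N, 2 < p j
  inj : ∀ i < N, ∀ j < N, p i = p j → i = j
  e_pos : 0 < e
  not_dvd : ∀ j < N, ¬ p j ∣ t j

namespace Sys

variable (S : Sys)

/-- `K = ∏_{j<N} pⱼ^e`. [cite: MandersAdleman1978, §2 (p. 171)] -/
def K : ℕ := ∏ j ∈ range S.N, S.p j ^ S.e

/-- `Qⱼ = ∏_{i<N, i≠j} pᵢ^e`. [cite: MandersAdleman1978, §2 (p. 171)] -/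
def Q (j : ℕ) : ℕ := ∏ i ∈ (range S.N).erase j, S.p i ^ S.e

/-- `θⱼ = Qⱼ · tⱼ`. [cite: MandersAdleman1978, §2 (p. 171)] -/
def θ (j : ℕ) : ℕ := S.Q j * S.t j

/-- `H = ∑_{j<N} θⱼ`. [cite: MandersAdleman1978, §2 (p. 171)] -/
def H : ℕ := ∑ j ∈ range S.N, S.θ j

/-- The signed sum `∑_{j<N} αⱼ θⱼ` of a sign vector `α = sgn ∘ ε`. [cite: MandersAdleman1978, §2 Lemma 1 (p. 178)] -/
def ssum (ε : ℕ → Bool) : ℤ := ∑ j ∈ range S.N, sgn (ε j) * (S.θ j : ℤ)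

variable {S}

/-- `Qⱼ · pⱼ^e = K`. [folklore] -/
theorem Q_mul_pow {j : ℕ} (hj : j < S.N) : S.Q j * S.p j ^ S.e = S.K := by
  unfold Q K; exact prod_erase_mul _ _ (mem_range.2 hj)

/-- The bases are positive. [folklore] -/
theorem p_pos {j : ℕ} (hj : j < S.N) : 0 < S.p j := (S.prime j hj).pos

/-- `0 < K`. [folklore] -/
theorem K_pos : 0 < S.K := prod_pos fun _ hj => pow_pos (p_pos (mem_range.1 hj)) _

/-- `0 < Qⱼ`. [folklore] -/
theorem Q_pos (j : ℕ) : 0 < S.Q j := prod_pos fun _ hi => pow_pos (p_pos (mem_range.1 (mem_of_mem_erase hi))) _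

/-- `pⱼ^e ∣ Qᵢ` for `i ≠ j`. [folklore] -/
theorem pow_dvd_Q {i j : ℕ} (hj : j < S.N) (hij : i ≠ j) : S.p j ^ S.e ∣ S.Q i :=
  dvd_prod_of_mem _ (mem_erase.2 ⟨fun h => hij h.symm, mem_range.2 hj⟩)

/-- `pⱼ^e ∣ θᵢ` for `i ≠ j`. [cite: MandersAdleman1978, §2 (p. 171: θⱼ ≡ 0 mod ∏_{i≠j} pᵢ^{n+1})] -/
theorem pow_dvd_θ {i j : ℕ} (hj : j < S.N) (hij : i ≠ j) : S.p j ^ S.e ∣ S.θ i :=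
  (pow_dvd_Q hj hij).mul_right _

/-- `pⱼ ∣ θᵢ` for `i ≠ j` (as `e ≥ 1`). [folklore] -/
theorem p_dvd_θ {i j : ℕ} (hj : j < S.N) (hij : i ≠ j) : S.p j ∣ S.θ i :=
  (dvd_pow_self _ (Nat.pos_iff_ne_zero.1 S.e_pos)).trans (pow_dvd_θ hj hij)

/-- `pⱼ ∤ Qⱼ` (the bases are distinct primes). [folklore] -/
theorem not_p_dvd_Q {j : ℕ} (hj : j < S.N) : ¬ S.p j ∣ S.Q j := by
  intro h
  unfold Q at h
  rw [(Nat.prime_iff.1 (S.prime j hj)).dvd_finsetProd_iff] at h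
  obtain ⟨i, hi, hdvd⟩ := h
  obtain ⟨hij, hi'⟩ := mem_erase.1 hi
  have hi'' := mem_range.1 hi'
  have := (Nat.prime_dvd_prime_iff_eq (S.prime j hj) (S.prime i hi'')).1 ((S.prime j hj).dvd_of_dvd_pow hdvd)
  exact hij (S.inj i hi'' j hj this.symm)

/-- `pⱼ ∤ θⱼ`. [cite: MandersAdleman1978, §2 (p. 171: θⱼ ≢ 0 mod pⱼ)] -/
theorem not_p_dvd_θ {j : ℕ} (hj : j < S.N) : ¬ S.p j ∣ S.θ j := fun h => by
  rcases (S.prime j hj).dvd_mul.1 h with h | h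
  · exact not_p_dvd_Q hj h
  · exact S.not_dvd j hj h

/-- `H ≡ θⱼ (mod pⱼ)`: all other summands are multiples of `pⱼ`. [cite: MandersAdleman1978, §2 Lemma 1 (proof)] -/
theorem H_modEq_θ {j : ℕ} (hj : j < S.N) : S.H ≡ S.θ j [MOD S.p j] := by
  unfold H
  rw [← add_sum_erase _ _ (mem_range.2 hj)]
  conv_rhs => rw [← Nat.add_zero (S.θ j)]
  refine Nat.ModEq.add_left _ ((Nat.modEq_zero_iff_dvd).2 (dvd_sum fun i hi => ?_))
  obtain ⟨hij, -⟩ := mem_erase.1 hi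
  exact p_dvd_θ hj hij

/-- **`pⱼ ∤ H`** ("`p_{j₀} ∣ H`, i.e. `p_{j₀} ∣ ∑ θⱼ` … it would have to be that `p_{j₀} ∣ θ_{j₀}`,
contradicting the third condition"). [cite: MandersAdleman1978, §2 Lemma 1 (proof, p. 178)] -/
theorem not_p_dvd_H {j : ℕ} (hj : j < S.N) : ¬ S.p j ∣ S.H := fun h =>
  not_p_dvd_θ hj ((Nat.ModEq.dvd_iff (H_modEq_θ hj) dvd_rfl).1 h)

/-- `(H : ℤ) ≡ θⱼ (mod pⱼ^e)`. [cite: MandersAdleman1978, §2 Lemma 1 (proof)] -/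
theorem H_modEq_θ_pow {j : ℕ} (hj : j < S.N) : (S.H : ℤ) ≡ S.θ j [ZMOD (S.p j : ℤ) ^ S.e] := by
  have : S.H ≡ S.θ j [MOD S.p j ^ S.e] := by
    unfold H
    rw [← add_sum_erase _ _ (mem_range.2 hj)]
    conv_rhs => rw [← Nat.add_zero (S.θ j)]
    refine Nat.ModEq.add_left _ ((Nat.modEq_zero_iff_dvd).2 (dvd_sum fun i hi => ?_))
    obtain ⟨hij, -⟩ := mem_erase.1 hi
    exact pow_dvd_θ hj hij
  have h := (Int.natCast_modEq_iff).2 this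
  push_cast at h
  exact h

/-- `∑ αᵢ θᵢ ≡ αⱼ θⱼ (mod pⱼ^e)`. [cite: MandersAdleman1978, §2 Lemma 1 (proof: "∑ αⱼθⱼ ≡ αⱼH")] -/
theorem ssum_modEq (ε : ℕ → Bool) {j : ℕ} (hj : j < S.N) :
    S.ssum ε ≡ sgn (ε j) * S.θ j [ZMOD (S.p j : ℤ) ^ S.e] := by
  unfold ssum
  rw [← add_sum_erase _ _ (mem_range.2 hj)]
  conv_rhs => rw [← add_zero (sgn (ε j) * (S.θ j : ℤ))]
  refine Int.ModEq.add_left _ ((Int.modEq_zero_iff_dvd).2 (dvd_sum fun i hi => ?_))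
  obtain ⟨hij, -⟩ := mem_erase.1 hi
  have : ((S.p j : ℤ) ^ S.e) ∣ (S.θ i : ℤ) := by exact_mod_cast pow_dvd_θ hj hij
  exact this.mul_left _

/-- `|∑ αⱼ θⱼ| ≤ H`. [cite: MandersAdleman1978, §2 Lemma 1 (proof: "−H ≤ x' ≤ H")] -/
theorem abs_ssum_le (ε : ℕ → Bool) : |S.ssum ε| ≤ S.H := by
  unfold ssum H
  push_cast
  refine (abs_sum_le_sum_abs _ _).trans (le_of_eq (sum_congr rfl fun j _ => ?_))
  rw [abs_mul, abs_sgn, one_mul, Nat.abs_cast]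

/-- The prime powers `pⱼ^e` (as integers) are pairwise coprime on `range N`. [folklore] -/
theorem pairwise_isCoprime :
    ((range S.N : Finset ℕ) : Set ℕ).Pairwise (Function.onFun IsCoprime fun j => ((S.p j : ℤ) ^ S.e)) := by
  intro i hi j hj hij
  have hi' := mem_range.1 (mem_coe.1 hi)
  have hj' := mem_range.1 (mem_coe.1 hj)
  have hc : Nat.Coprime (S.p i) (S.p j) :=
    (Nat.coprime_primes (S.prime i hi') (S.prime j hj')).2 fun h => hij (S.inj i hi' j hj' h)
  exact (Nat.isCoprime_iff_coprime.2 hc).pow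

/-- `(K : ℤ) = ∏ (pⱼ : ℤ)^e`. [folklore] -/
theorem cast_K : (S.K : ℤ) = ∏ j ∈ range S.N, (S.p j : ℤ) ^ S.e := by
  unfold K; push_cast; rfl

/-- **Chinese remaindering for `K`**: `K ∣ z` iff `pⱼ^e ∣ z` for every `j < N`. [folklore] -/
theorem K_dvd_iff (z : ℤ) : (S.K : ℤ) ∣ z ↔ ∀ j < S.N, ((S.p j : ℤ) ^ S.e) ∣ z := by
  rw [cast_K]
  constructor
  · intro h j hj
    exact (dvd_prod_of_mem _ (mem_range.2 hj)).trans h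
  · intro h
    exact prod_dvd_of_coprime pairwise_isCoprime fun j hj => h j (mem_range.1 hj)

/-- **The key dichotomy**: if `pⱼ^e ∣ (H + x)(H − x)` then `pⱼ^e ∣ H + x` or `pⱼ^e ∣ H − x`
("Assume (for reductio) that `p_{j₀} ∣ H + x` and `p_{j₀} ∣ H − x`. Then `p_{j₀} ∣ 2H`. But
`p_{j₀} > 2`, prime, so `p_{j₀} ∣ H` … contradiction"). [cite: MandersAdleman1978, §2 Lemma 1 (proof, p. 178)] -/
theorem pow_dvd_add_or_sub {j : ℕ} (hj : j < S.N) {x : ℤ}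
    (h : ((S.p j : ℤ) ^ S.e) ∣ (S.H + x) * (S.H - x)) :
    ((S.p j : ℤ) ^ S.e) ∣ S.H + x ∨ ((S.p j : ℤ) ^ S.e) ∣ S.H - x := by
  have hp : Prime (S.p j : ℤ) := Nat.prime_iff_prime_int.1 (S.prime j hj)
  by_cases h1 : (S.p j : ℤ) ∣ S.H + x
  · by_cases h2 : (S.p j : ℤ) ∣ S.H - x
    · exfalso
      have h2H : (S.p j : ℤ) ∣ 2 * S.H := by
        have : (2 : ℤ) * S.H = (S.H + x) + (S.H - x) := by ring
        rw [this]; exact dvd_add h1 h2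
      rcases hp.dvd_or_dvd h2H with h3 | h3
      · have : (S.p j : ℤ) ≤ 2 := Int.le_of_dvd (by norm_num) h3
        have := S.two_lt j hj
        omega
      · exact not_p_dvd_H hj (by exact_mod_cast h3)
    · exact Or.inl (((hp.coprime_iff_not_dvd).2 h2).pow_left.dvd_of_dvd_mul_right h)
  · exact Or.inr (((hp.coprime_iff_not_dvd).2 h1).pow_left.dvd_of_dvd_mul_left h)

/-- **Manders–Adleman, Lemma 1.** Suppose `2H < K`. For an integer `x` with `|x| ≤ H`:
`K ∣ (H + x)(H − x)` iff `x = ∑ⱼ αⱼ θⱼ` for some `αⱼ ∈ {−1, +1}`. (→) each `pⱼ^e` divides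
exactly one of `H ± x`, defining `αⱼ`; then `x ≡ αⱼ H ≡ αⱼ θⱼ ≡ x'` modulo every `pⱼ^e`, so
`K ∣ x − x'` with `|x − x'| ≤ 2H < K`. (←) `∑ αᵢθᵢ ≡ αⱼθⱼ ≡ αⱼ H (mod pⱼ^e)`.
[cite: MandersAdleman1978, §2 Lemma 1 (p. 178)] -/
theorem lemma1 (hHK : 2 * S.H < S.K) {x : ℤ} (hx : |x| ≤ S.H) :
    (S.K : ℤ) ∣ (S.H + x) * (S.H - x) ↔ ∃ ε : ℕ → Bool, x = S.ssum ε := by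
  constructor
  · intro h
    rw [K_dvd_iff] at h
    set ε : ℕ → Bool := fun j => decide (((S.p j : ℤ) ^ S.e) ∣ S.H - x) with hε
    refine ⟨ε, ?_⟩
    -- `x ≡ x'` modulo every `pⱼ^e`
    have hmod : ∀ j < S.N, ((S.p j : ℤ) ^ S.e) ∣ x - S.ssum ε := fun j hj => by
      have hs := ssum_modEq ε hj
      have hH := H_modEq_θ_pow hj
      rcases pow_dvd_add_or_sub hj (h j hj) with h' | h'
      · -- `pⱼ^e ∣ H + x`: then `εⱼ = false` unless it also divides `H - x`
        by_cases hm : ((S.p j : ℤ) ^ S.e) ∣ S.H - x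
        · have hεj : ε j = true := by rw [hε]; exact decide_eq_true hm
          rw [hεj, sgn_true, one_mul] at hs
          -- `x ≡ H ≡ θⱼ ≡ ssum`
          have h1 : x ≡ S.H [ZMOD (S.p j : ℤ) ^ S.e] := Int.modEq_iff_dvd.2 hm
          exact (Int.ModEq.dvd ((h1.trans hH).trans hs.symm).symm)
        · have hεj : ε j = false := by rw [hε]; exact decide_eq_false hm
          rw [hεj, sgn_false, neg_one_mul] at hs
          have h1 : x ≡ -S.H [ZMOD (S.p j : ℤ) ^ S.e] :=
            Int.modEq_iff_dvd.2 (by have := h'; rwa [show -(S.H : ℤ) - x = -(S.H + x) by ring, Int.dvd_neg])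
          exact Int.ModEq.dvd ((h1.trans hH.neg).trans hs.symm).symm
      · have hεj : ε j = true := by rw [hε]; exact decide_eq_true h'
        rw [hεj, sgn_true, one_mul] at hs
        have h1 : x ≡ S.H [ZMOD (S.p j : ℤ) ^ S.e] := Int.modEq_iff_dvd.2 h'
        exact Int.ModEq.dvd ((h1.trans hH).trans hs.symm).symm
    have hK : (S.K : ℤ) ∣ x - S.ssum ε := (K_dvd_iff _).2 hmod
    have habs : |x - S.ssum ε| < S.K := by
      have h1 := abs_sub (x : ℤ) (S.ssum ε)
      have h2 := abs_ssum_le (S := S) ε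
      have h3 : ((2 * S.H : ℕ) : ℤ) < S.K := by exact_mod_cast hHK
      push_cast at h3
      linarith
    have := Int.eq_zero_of_abs_lt_dvd hK habs
    linarith
  · rintro ⟨ε, rfl⟩
    rw [K_dvd_iff]
    intro j hj
    have hs := ssum_modEq ε hj
    have hH := H_modEq_θ_pow hj
    cases hb : ε j
    · rw [hb, sgn_false, neg_one_mul] at hs
      -- `H + x ≡ θⱼ - θⱼ = 0`
      have : ((S.p j : ℤ) ^ S.e) ∣ S.H + S.ssum ε := by
        have h1 : (S.H : ℤ) + S.ssum ε ≡ S.θ j + -(S.θ j : ℤ) [ZMOD (S.p j : ℤ) ^ S.e] := hH.add hs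
        rw [add_neg_cancel] at h1
        exact (Int.modEq_zero_iff_dvd).1 h1
      exact this.mul_right _
    · rw [hb, sgn_true, one_mul] at hs
      have : ((S.p j : ℤ) ^ S.e) ∣ S.H - S.ssum ε := by
        have h1 : (S.H : ℤ) - S.ssum ε ≡ S.θ j - (S.θ j : ℤ) [ZMOD (S.p j : ℤ) ^ S.e] := hH.sub hs
        rw [sub_self] at h1
        exact (Int.modEq_zero_iff_dvd).1 h1
      exact this.mul_left _

end Sys

/-! ### From the `±1` equation to one quadratic congruence -/

/-- **The data of the reduction** (M–A systems (I)–(III)): a Chinese-remainder system `S`,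
natural coefficients `cⱼ`, an odd target `τ` and a precision `s` with `∑ cⱼ + |τ| < 2^s`
(so that `∑ cⱼ αⱼ ≡ τ (mod 2^s)` already forces equality), the congruences `θⱼ ≡ cⱼ (mod 2^s)`,
and the size condition `2H < K` of Lemma 1. [cite: MandersAdleman1978, §2 (systems (I)–(III), pp. 176–177)] -/
structure Inst where
  /-- the Chinese-remainder data `pⱼ, tⱼ, e` -/
  S : Sys
  /-- the coefficients of the `±1` equation -/
  c : ℕ → ℕ
  /-- the (odd) target -/
  τ : ℤ
  /-- the precision: everything happens modulo `2^s` -/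
  s : ℕ
  τ_odd : Odd τ
  small : (∑ j ∈ range S.N, (c j : ℤ)) + |τ| < 2 ^ s
  cong : ∀ j < S.N, (S.θ j : ℤ) ≡ c j [ZMOD (2 : ℤ) ^ s]
  HK : 2 * S.H < S.K

namespace Inst

variable (I : Inst)

/-- The signed coefficient sum `∑_{j<N} αⱼ cⱼ`. [cite: MandersAdleman1978, §2 (system before Lemma 1)] -/
def csum (ε : ℕ → Bool) : ℤ := ∑ j ∈ range I.S.N, sgn (ε j) * (I.c j : ℤ)

variable {I}

/-- `1 ≤ s`: the precision is positive (`|τ| ≥ 1`). [folklore] -/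
theorem one_le_s : 1 ≤ I.s := by
  by_contra h
  have hs : I.s = 0 := by omega
  have h1 := I.small
  rw [hs, pow_zero] at h1
  have h2 : (1 : ℤ) ≤ |I.τ| := by
    obtain ⟨k, hk⟩ := I.τ_odd
    rw [hk]; rcases le_or_gt 0 k with h | h
    · rw [abs_of_nonneg (by linarith)]; linarith
    · rw [abs_of_neg (by linarith)]; linarith
  have h3 : (0 : ℤ) ≤ ∑ j ∈ range I.S.N, (I.c j : ℤ) := sum_nonneg fun j _ => Nat.cast_nonneg _
  linarith

/-- Sums of congruent terms are congruent. [folklore] -/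
theorem modEq_sum_range {n : ℤ} {m : ℕ} {f g : ℕ → ℤ} (h : ∀ j < m, f j ≡ g j [ZMOD n]) :
    ∑ j ∈ range m, f j ≡ ∑ j ∈ range m, g j [ZMOD n] := by
  induction m with
  | zero => simp [Int.ModEq.refl]
  | succ m ih =>
    rw [sum_range_succ, sum_range_succ]
    exact (ih fun j hj => h j (by omega)).add (h m (by omega))

/-- `csum ε ≡ ssum ε (mod 2^s)` (termwise `θⱼ ≡ cⱼ`). [cite: MandersAdleman1978, §2 ("By definition of θⱼ this is equivalent to …")] -/
theorem csum_modEq_ssum (ε : ℕ → Bool) : I.csum ε ≡ I.S.ssum ε [ZMOD (2 : ℤ) ^ I.s] :=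
  modEq_sum_range fun j hj => ((I.cong j hj).symm).mul_left _

/-- `csum (¬ε) = − csum ε`. [folklore] -/
theorem csum_not (ε : ℕ → Bool) : I.csum (fun j => !ε j) = -I.csum ε := by
  unfold csum
  rw [← sum_neg_distrib]
  exact sum_congr rfl fun j _ => by rw [sgn_not, neg_mul]

/-- `|csum ε − τ| < 2^s`. [cite: MandersAdleman1978, §2 ("the modulo has no impact on the satisfiability")] -/
theorem abs_csum_sub_lt (ε : ℕ → Bool) : |I.csum ε - I.τ| < (2 : ℤ) ^ I.s := by
  have h1 : |I.csum ε| ≤ ∑ j ∈ range I.S.N, (I.c j : ℤ) := by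
    unfold csum
    refine (abs_sum_le_sum_abs _ _).trans (le_of_eq (sum_congr rfl fun j _ => ?_))
    rw [abs_mul, abs_sgn, one_mul, Nat.abs_cast]
  have h2 := abs_sub (I.csum ε) I.τ
  have h3 := I.small
  linarith

/-- A congruence `csum ε ≡ τ (mod 2^s)` is an equality. [cite: MandersAdleman1978, §2 (system (I))] -/
theorem csum_eq_of_modEq {ε : ℕ → Bool} (h : I.csum ε ≡ I.τ [ZMOD (2 : ℤ) ^ I.s]) : I.csum ε = I.τ := by
  have hd : (2 : ℤ) ^ I.s ∣ I.csum ε - I.τ := (Int.ModEq.dvd h.symm)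
  have := Int.eq_zero_of_abs_lt_dvd hd (abs_csum_sub_lt ε)
  linarith

/-- `2^{s+1}` and `K` are coprime (`K` is odd). [folklore] -/
theorem coprime_two_pow_K : Nat.Coprime (2 ^ (I.s + 1)) I.S.K := by
  refine Nat.Coprime.pow_left _ ?_
  unfold Sys.K
  refine Nat.Coprime.prod_right fun j hj => Nat.Coprime.pow_right _ ?_
  exact (Nat.coprime_primes Nat.prime_two (I.S.prime j (mem_range.1 hj))).2
    (fun h => absurd (I.S.two_lt j (mem_range.1 hj)) (by omega))

/-- **The main equivalence** (Manders–Adleman, systems (I) ⟺ (II) ⟺ (III)): for any `A` with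
`A ≡ τ² (mod 2^{s+1})` and `A ≡ H² (mod K)`, the equation `∑ αⱼ cⱼ = τ` has a `±1` solution iff
some natural `x ≤ H` satisfies `x² ≡ A (mod 2^{s+1}·K)`. (→) `x = |∑ αⱼθⱼ|`: `x ≡ ±τ (mod 2^s)`
gives `x² ≡ τ² (mod 2^{s+1})`, Lemma 1 gives `x² ≡ H² (mod K)`. (←) Lemma 1 writes `x = ∑ αⱼθⱼ`,
Lemma 2 gives `x ≡ ±τ (mod 2^s)`, hence `∑ (±αⱼ) cⱼ ≡ τ (mod 2^s)`, an equality by the size bound.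
[cite: MandersAdleman1978, §2 (proof of correctness, pp. 176–178)] -/
theorem main {A : ℕ} (hAM : (A : ℤ) ≡ I.τ ^ 2 [ZMOD (2 : ℤ) ^ (I.s + 1)]) (hAK : A ≡ I.S.H ^ 2 [MOD I.S.K]) :
    (∃ ε : ℕ → Bool, I.csum ε = I.τ) ↔ ∃ x : ℕ, x ≤ I.S.H ∧ x ^ 2 ≡ A [MOD 2 ^ (I.s + 1) * I.S.K] := by
  have hs := one_le_s (I := I)
  constructor
  · rintro ⟨ε, hε⟩
    set X : ℤ := I.S.ssum ε with hX
    have hXH : |X| ≤ I.S.H := Sys.abs_ssum_le ε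
    -- modulo `2^{s+1}`
    have h1 : X ≡ I.τ [ZMOD (2 : ℤ) ^ I.s] := (csum_modEq_ssum ε).symm.trans (by rw [hε])
    have h2 : X ^ 2 ≡ I.τ ^ 2 [ZMOD (2 : ℤ) ^ (I.s + 1)] := by
      obtain ⟨k, hk⟩ := (Int.modEq_iff_dvd.1 h1.symm)
      obtain ⟨s', hs'⟩ : ∃ s', I.s = s' + 1 := ⟨I.s - 1, by omega⟩
      rw [hs'] at hk ⊢
      have hXe : X = I.τ + 2 ^ (s' + 1) * k := by linarith
      refine (Int.modEq_iff_dvd.2 ⟨-(k * I.τ + 2 ^ s' * k ^ 2), ?_⟩)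
      rw [hXe]; ring
    -- modulo `K` (Lemma 1, ←)
    have h3 : (I.S.K : ℤ) ∣ (I.S.H + X) * (I.S.H - X) := (Sys.lemma1 I.HK hXH).2 ⟨ε, rfl⟩
    refine ⟨X.natAbs, ?_, ?_⟩
    · have : (X.natAbs : ℤ) ≤ I.S.H := by rw [Int.natCast_natAbs]; exact hXH
      exact_mod_cast this
    · rw [← Nat.modEq_and_modEq_iff_modEq_mul coprime_two_pow_K]
      constructor
      · rw [← Int.natCast_modEq_iff]; push_cast; rw [sq_abs]
        exact h2.trans hAM.symm
      · rw [← Int.natCast_modEq_iff]; push_cast; rw [sq_abs]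
        have h4 : X ^ 2 ≡ (I.S.H : ℤ) ^ 2 [ZMOD I.S.K] := by
          refine (Int.modEq_iff_dvd.2 ?_)
          have : (I.S.H : ℤ) ^ 2 - X ^ 2 = (I.S.H + X) * (I.S.H - X) := by ring
          rw [this]; exact h3
        have h5 : ((I.S.H ^ 2 : ℕ) : ℤ) ≡ A [ZMOD I.S.K] := (Int.natCast_modEq_iff.2 hAK).symm
        push_cast at h5
        exact h4.trans h5
  · rintro ⟨x, hxH, hx⟩
    obtain ⟨hx2, hxK⟩ := (Nat.modEq_and_modEq_iff_modEq_mul coprime_two_pow_K).2 hx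
    -- Lemma 1 (→): `x = ∑ αⱼ θⱼ`
    have hK : (I.S.K : ℤ) ∣ (I.S.H + x) * (I.S.H - x) := by
      have h5 : ((x ^ 2 : ℕ) : ℤ) ≡ ((I.S.H ^ 2 : ℕ) : ℤ) [ZMOD I.S.K] := Int.natCast_modEq_iff.2 (hxK.trans hAK)
      push_cast at h5
      have : ((I.S.H : ℤ) + x) * (I.S.H - x) = I.S.H ^ 2 - (x : ℤ) ^ 2 := by ring
      rw [this]
      exact Int.modEq_iff_dvd.1 h5
    obtain ⟨ε, hε⟩ := (Sys.lemma1 I.HK (x := (x : ℤ)) (by rw [Nat.abs_cast]; exact_mod_cast hxH)).1 hK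
    -- Lemma 2: `x ≡ ±τ (mod 2^s)`
    have h2 : (2 : ℤ) ^ (I.s + 1) ∣ (I.τ + x) * (I.τ - x) := by
      have h5 : ((x ^ 2 : ℕ) : ℤ) ≡ (A : ℤ) [ZMOD ((2 ^ (I.s + 1) : ℕ) : ℤ)] := Int.natCast_modEq_iff.2 hx2
      push_cast at h5
      have : (I.τ + x) * (I.τ - x) = I.τ ^ 2 - (x : ℤ) ^ 2 := by ring
      rw [this]
      exact Int.modEq_iff_dvd.1 (h5.trans hAM)
    rcases two_pow_dvd_add_or_sub I.τ_odd h2 with h | h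
    · -- `x ≡ -τ`: flip all signs
      refine ⟨fun j => !ε j, csum_eq_of_modEq ?_⟩
      rw [csum_not]
      have h6 : I.csum ε ≡ x [ZMOD (2 : ℤ) ^ I.s] := (csum_modEq_ssum ε).trans (by rw [← hε])
      have h7 : -(x : ℤ) ≡ I.τ [ZMOD (2 : ℤ) ^ I.s] :=
        Int.modEq_iff_dvd.2 (by rwa [show I.τ - -(x : ℤ) = I.τ + x by ring])
      exact h6.neg.trans h7
    · refine ⟨ε, csum_eq_of_modEq ?_⟩
      have h6 : I.csum ε ≡ x [ZMOD (2 : ℤ) ^ I.s] := (csum_modEq_ssum ε).trans (by rw [← hε])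
      exact h6.trans (Int.modEq_iff_dvd.2 h)

/-- `A` is odd (it is `≡ τ²` modulo the even number `2^{s+1}`). [folklore] -/
theorem A_odd {A : ℕ} (hAM : (A : ℤ) ≡ I.τ ^ 2 [ZMOD (2 : ℤ) ^ (I.s + 1)]) : Odd A := by
  have h2 : (A : ℤ) ≡ I.τ ^ 2 [ZMOD 2] :=
    Int.ModEq.of_dvd (dvd_pow_self 2 (Nat.succ_ne_zero _)) hAM
  have hτ2 : Odd (I.τ ^ 2) := I.τ_odd.pow
  rw [← Int.odd_coe_nat]
  rw [Int.odd_iff] at hτ2 ⊢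
  rw [Int.ModEq] at h2
  omega

/-- **QUADRATIC CONGRUENCES form of the main equivalence**: with `A` as in `main`, the `±1`
equation is solvable iff `(A, 2^{s+1}K, H + 1)` is a yes-instance of Garey–Johnson's [AN1]
(`0 < x < H + 1`; `x = 0` is excluded automatically since `A` is odd and the modulus even, and
`A, 2^{s+1}K > 0`). [cite: MandersAdleman1978, §2 Thm. 2] [cite: GareyJohnson1979, §A7.1 problem AN1] -/
theorem main_quadCongSet {A : ℕ} (hAM : (A : ℤ) ≡ I.τ ^ 2 [ZMOD (2 : ℤ) ^ (I.s + 1)])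
    (hAK : A ≡ I.S.H ^ 2 [MOD I.S.K]) :
    (∃ ε : ℕ → Bool, I.csum ε = I.τ) ↔ (A, 2 ^ (I.s + 1) * I.S.K, I.S.H + 1) ∈ quadCongSet := by
  rw [main hAM hAK, mem_quadCongSet_iff]
  have hA : Odd A := A_odd hAM
  have hApos : 0 < A := Nat.pos_of_ne_zero fun h => by rw [h] at hA; exact Nat.not_odd_zero hA
  have hBpos : 0 < 2 ^ (I.s + 1) * I.S.K := Nat.mul_pos (pow_pos (by norm_num) _) Sys.K_pos
  constructor
  · rintro ⟨x, hxH, hx⟩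
    refine ⟨hApos, hBpos, x, Nat.pos_of_ne_zero ?_, Nat.lt_succ_of_le hxH, hx⟩
    rintro rfl
    -- `0 ≡ A (mod 2^{s+1} K)` contradicts `A` odd
    have h2 : 2 ∣ A := by
      have h1 : (2 ^ (I.s + 1) * I.S.K) ∣ A := by
        have := (Nat.modEq_zero_iff_dvd).1 hx.symm
        simpa using this
      exact (Dvd.dvd.mul_right (dvd_pow_self 2 (Nat.succ_ne_zero _)) _).trans h1
    exact (Nat.not_even_iff_odd.2 hA) (even_iff_two_dvd.2 h2)
  · rintro ⟨-, -, x, -, hxc, hx⟩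
    exact ⟨x, Nat.le_of_lt_succ hxc, hx⟩

end Inst

/-! ### An admissible choice of `tⱼ` by one modular inverse, and the size bound `2H < K` -/

/-- The multiplier chosen from the coefficient `c`: `t₀ = c · Q^{2^{s-1} - 1} mod 2^s` (so
`Q t₀ ≡ c`, Euler's theorem modulo `2^s`), then `t = t₀ + 2^s` if `p ∣ t₀` else `t = t₀` (exactly
the computation of the machine: one modular exponentiation, one product, two remainders, one test).
[cite: MandersAdleman1978, §2.2 ("the inverse can be found in polynomial time using the Euclidean algorithm")] -/
def tOf (s Q p c : ℕ) : ℕ :=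
  if p ∣ c * (Q ^ (2 ^ (s - 1) - 1) % 2 ^ s) % 2 ^ s then c * (Q ^ (2 ^ (s - 1) - 1) % 2 ^ s) % 2 ^ s + 2 ^ s
  else c * (Q ^ (2 ^ (s - 1) - 1) % 2 ^ s) % 2 ^ s

/-- `tOf < 2^{s+1}`. [folklore] -/
theorem tOf_lt (s Q p c : ℕ) : tOf s Q p c < 2 ^ (s + 1) := by
  have h := Nat.mod_lt (c * (Q ^ (2 ^ (s - 1) - 1) % 2 ^ s)) (pow_pos (by norm_num : 0 < 2) s)
  unfold tOf; split_ifs <;> rw [pow_succ] <;> omega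

/-- `p ∤ tOf` for an odd prime `p`. [cite: MandersAdleman1978, §2 (p. 171: θⱼ ≢ 0 mod pⱼ)] -/
theorem not_dvd_tOf {s Q p c : ℕ} (hp : p.Prime) (hp2 : p ≠ 2) : ¬ p ∣ tOf s Q p c := by
  unfold tOf
  split_ifs with h
  · intro h'
    have h2 : p ∣ 2 ^ s := (Nat.dvd_add_right h).1 h'
    exact hp2 ((Nat.prime_dvd_prime_iff_eq hp Nat.prime_two).1 (hp.dvd_of_dvd_pow h2))
  · exact h

/-- `Q · tOf ≡ c (mod 2^s)` for odd `Q` and `s ≥ 1` (Euler: `Q^{2^{s-1}} ≡ 1 (mod 2^s)`).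
[cite: MandersAdleman1978, §2 (p. 171: θⱼ ≡ cⱼ mod 2^s)] -/
theorem mul_tOf_modEq {s Q p c : ℕ} (hs : 1 ≤ s) (hQ : Odd Q) : Q * tOf s Q p c ≡ c [MOD 2 ^ s] := by
  have ht : tOf s Q p c ≡ c * (Q ^ (2 ^ (s - 1) - 1) % 2 ^ s) % 2 ^ s [MOD 2 ^ s] := by
    unfold tOf; split_ifs
    · exact Nat.add_modEq_right
    · rfl
  have hcop : Nat.Coprime Q (2 ^ s) := Nat.Coprime.pow_right _ (Nat.coprime_two_right.2 hQ)
  have heuler : Q ^ (2 ^ (s - 1)) ≡ 1 [MOD 2 ^ s] := by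
    have := Nat.ModEq.pow_totient hcop
    rwa [Nat.totient_prime_pow Nat.prime_two hs, show (2 - 1 : ℕ) = 1 from rfl, mul_one] at this
  have hpow : Q * Q ^ (2 ^ (s - 1) - 1) = Q ^ (2 ^ (s - 1)) := by
    rw [← pow_succ']; congr 1; have := Nat.one_le_two_pow (n := s - 1); omega
  calc Q * tOf s Q p c ≡ Q * (c * (Q ^ (2 ^ (s - 1) - 1) % 2 ^ s) % 2 ^ s) [MOD 2 ^ s] := ht.mul_left _
    _ ≡ Q * (c * (Q ^ (2 ^ (s - 1) - 1))) [MOD 2 ^ s] :=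
        ((Nat.mod_modEq _ _).trans ((Nat.mod_modEq _ _).mul_left _)).mul_left _
    _ = c * (Q * Q ^ (2 ^ (s - 1) - 1)) := by ring
    _ ≡ c * 1 [MOD 2 ^ s] := by rw [hpow]; exact heuler.mul_left _
    _ = c := mul_one c

/-- **The size bound `2H < K`** for bases `≥ 3`, multipliers `< 2^{s+1}` and an exponent
`e ≥ s + N + 2`: `3^e θⱼ ≤ K tⱼ < K 2^{s+1}`, so `3^e H < N 2^{s+1} K ≤ 3^e K / 2`
(M–A: "by our choice of `pⱼ > (4(n+1)8^{m+1})^{1/(n+1)}` … each term of `H` is bounded by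
`K/2(n+1)`. Hence `2H < K`" — here the exponent, not the primes, is taken large).
[cite: MandersAdleman1978, §2 Lemma 1 (proof, p. 178: "Hence 2H < K")] -/
theorem two_mul_H_lt_K (S : Sys) {s : ℕ} (h3 : ∀ j < S.N, 3 ≤ S.p j) (ht : ∀ j < S.N, S.t j < 2 ^ (s + 1))
    (he : s + S.N + 2 ≤ S.e) : 2 * S.H < S.K := by
  rcases Nat.eq_zero_or_pos S.N with hN | hN
  · have hH : S.H = 0 := by unfold Sys.H; rw [hN, sum_range_zero]
    rw [hH]; exact Sys.K_pos
  -- `3^e θⱼ < 2^{s+1} K` for every `j`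
  have hterm : ∀ j ∈ range S.N, 3 ^ S.e * S.θ j < 2 ^ (s + 1) * S.K := fun j hj => by
    have hj' := mem_range.1 hj
    have h1 : 3 ^ S.e * S.Q j ≤ S.K := by
      rw [← Sys.Q_mul_pow hj', mul_comm]
      exact Nat.mul_le_mul_left _ (Nat.pow_le_pow_left (h3 j hj') _)
    unfold Sys.θ
    calc 3 ^ S.e * (S.Q j * S.t j) = (3 ^ S.e * S.Q j) * S.t j := by ring
      _ ≤ S.K * S.t j := Nat.mul_le_mul_right _ h1
      _ < S.K * 2 ^ (s + 1) := Nat.mul_lt_mul_of_pos_left (ht j hj') Sys.K_pos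
      _ = 2 ^ (s + 1) * S.K := mul_comm _ _
  have hsum : 3 ^ S.e * S.H < S.N * (2 ^ (s + 1) * S.K) := by
    unfold Sys.H
    rw [mul_sum]
    calc ∑ j ∈ range S.N, 3 ^ S.e * S.θ j < ∑ j ∈ range S.N, 2 ^ (s + 1) * S.K :=
          sum_lt_sum_of_nonempty (nonempty_range_iff.2 (by omega)) hterm
      _ = S.N * (2 ^ (s + 1) * S.K) := by rw [sum_const, card_range, smul_eq_mul]
  -- `N 2^{s+2} ≤ 3^e`
  have hexp : S.N * 2 ^ (s + 2) ≤ 3 ^ S.e := by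
    calc S.N * 2 ^ (s + 2) ≤ 3 ^ S.N * 3 ^ (s + 2) :=
          Nat.mul_le_mul (Nat.lt_pow_self (by norm_num : 1 < 3)).le (Nat.pow_le_pow_left (by norm_num) _)
      _ = 3 ^ (s + S.N + 2) := by rw [← pow_add]; congr 1; omega
      _ ≤ 3 ^ S.e := Nat.pow_le_pow_right (by norm_num) he
  -- combine
  have hK := Sys.K_pos (S := S)
  have : 3 ^ S.e * (2 * S.H) < 3 ^ S.e * S.K := by
    calc 3 ^ S.e * (2 * S.H) = 2 * (3 ^ S.e * S.H) := by ring
      _ < 2 * (S.N * (2 ^ (s + 1) * S.K)) := by linarith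
      _ = (S.N * 2 ^ (s + 2)) * S.K := by rw [pow_succ]; ring
      _ ≤ 3 ^ S.e * S.K := Nat.mul_le_mul_right _ hexp
  exact Nat.lt_of_mul_lt_mul_left this

/-! ### The left-hand side `A` by one more modular inverse -/

/-- The inverse of (odd) `K` modulo `2^{s+1}`: `u = K^{2^s - 1} mod 2^{s+1}`. [folklore] -/
def uOf (s K : ℕ) : ℕ := K ^ (2 ^ s - 1) % 2 ^ (s + 1)

/-- **The number `A`** with `A ≡ H² (mod K)` and `A ≡ T² (mod 2^{s+1})`, written without signed
arithmetic: `A = H² + K · ((T² mod M + M − H² mod M) · u mod M)`, `M = 2^{s+1}` (Manders–Adleman's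
`α = (2·8^{m+1} + K)^{-1}(K τ² + 2·8^{m+1} H²)`, i.e. the Chinese-remainder combination, in a form
the machine computes with `prodFn`, `remFn`, `addFn`, `subFn`, `modExpFn`).
[cite: MandersAdleman1978, §2 (output α, β, γ of the reduction, p. 171)] -/
def aOf (s K H T : ℕ) : ℕ :=
  H ^ 2 + K * ((T ^ 2 % 2 ^ (s + 1) + 2 ^ (s + 1) - H ^ 2 % 2 ^ (s + 1)) * uOf s K % 2 ^ (s + 1))

/-- `A ≡ H² (mod K)`. [cite: MandersAdleman1978, §2 (system (III))] -/
theorem aOf_modEq_K (s K H T : ℕ) : aOf s K H T ≡ H ^ 2 [MOD K] := by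
  unfold aOf
  conv_rhs => rw [← Nat.add_zero (H ^ 2)]
  exact Nat.ModEq.add_left _ (Nat.modEq_zero_iff_dvd.2 (dvd_mul_right _ _))

/-- `K · u ≡ 1 (mod 2^{s+1})` for odd `K`. [folklore] -/
theorem K_mul_uOf_modEq {s K : ℕ} (hK : Odd K) : K * uOf s K ≡ 1 [MOD 2 ^ (s + 1)] := by
  have hcop : Nat.Coprime K (2 ^ (s + 1)) := Nat.Coprime.pow_right _ (Nat.coprime_two_right.2 hK)
  have heuler : K ^ (2 ^ s) ≡ 1 [MOD 2 ^ (s + 1)] := by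
    have := Nat.ModEq.pow_totient hcop
    rwa [Nat.totient_prime_pow Nat.prime_two (Nat.succ_pos s), show (2 - 1 : ℕ) = 1 from rfl, mul_one,
      Nat.succ_sub_one] at this
  have hpow : K * K ^ (2 ^ s - 1) = K ^ (2 ^ s) := by
    rw [← pow_succ']; congr 1; have := Nat.one_le_two_pow (n := s); omega
  unfold uOf
  calc K * (K ^ (2 ^ s - 1) % 2 ^ (s + 1)) ≡ K * K ^ (2 ^ s - 1) [MOD 2 ^ (s + 1)] := (Nat.mod_modEq _ _).mul_left _
    _ ≡ 1 [MOD 2 ^ (s + 1)] := by rw [hpow]; exact heuler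

/-- `A ≡ T² (mod 2^{s+1})` for odd `K`. [cite: MandersAdleman1978, §2 (system (III))] -/
theorem aOf_modEq_two_pow {s K : ℕ} (hK : Odd K) (H T : ℕ) : (aOf s K H T : ℤ) ≡ (T : ℤ) ^ 2 [ZMOD (2 : ℤ) ^ (s + 1)] := by
  set M : ℕ := 2 ^ (s + 1) with hM
  have hMpos : 0 < M := pow_pos (by norm_num) _
  -- over `ℕ`: `A ≡ H² + (T² % M + M - H² % M) (mod M)`
  have h1 : aOf s K H T ≡ H ^ 2 + (T ^ 2 % M + M - H ^ 2 % M) [MOD M] := by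
    unfold aOf
    refine Nat.ModEq.add_left _ ?_
    calc K * ((T ^ 2 % M + M - H ^ 2 % M) * uOf s K % M) ≡ K * ((T ^ 2 % M + M - H ^ 2 % M) * uOf s K) [MOD M] :=
          (Nat.mod_modEq _ _).mul_left _
      _ = (K * uOf s K) * (T ^ 2 % M + M - H ^ 2 % M) := by ring
      _ ≡ 1 * (T ^ 2 % M + M - H ^ 2 % M) [MOD M] := (K_mul_uOf_modEq hK).mul_right _
      _ = T ^ 2 % M + M - H ^ 2 % M := one_mul _
  have h2 := Int.natCast_modEq_iff.2 h1
  have hle : H ^ 2 % M ≤ T ^ 2 % M + M := (Nat.mod_lt _ hMpos).le.trans (Nat.le_add_left _ _)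
  push_cast [hle] at h2
  refine h2.trans ?_
  -- `H² + (T² % M + M - H² % M) ≡ T²`
  have h3 : ((H ^ 2 % M : ℕ) : ℤ) ≡ ((H ^ 2 : ℕ) : ℤ) [ZMOD (M : ℤ)] := Int.natCast_modEq_iff.2 (Nat.mod_modEq _ _)
  have h4 : ((T ^ 2 % M : ℕ) : ℤ) ≡ ((T ^ 2 : ℕ) : ℤ) [ZMOD (M : ℤ)] := Int.natCast_modEq_iff.2 (Nat.mod_modEq _ _)
  have h5 : (M : ℤ) ≡ 0 [ZMOD (M : ℤ)] := Int.modEq_zero_iff_dvd.2 dvd_rfl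
  push_cast at h3 h4 h5 ⊢
  have := ((h4.add h5).sub h3).add_left ((H : ℤ) ^ 2)
  refine this.trans ?_
  ring_nf
  exact Int.ModEq.refl _

/-! ### Prime supply: polynomially many candidates contain enough primes -/

/-- `(t + 1)² ≤ 2ᵗ` for `t ≥ 6`. [folklore] -/
theorem succ_sq_le_two_pow {t : ℕ} (ht : 6 ≤ t) : (t + 1) ^ 2 ≤ 2 ^ t := by
  induction t, ht using Nat.le_induction with
  | base => norm_num
  | succ t ht ih =>
    have h1 : 2 * t + 3 ≤ (t + 1) ^ 2 := by nlinarith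
    calc (t + 1 + 1) ^ 2 = (t + 1) ^ 2 + (2 * t + 3) := by ring
      _ ≤ 2 ^ t + 2 ^ t := Nat.add_le_add ih (h1.trans ih)
      _ = 2 ^ (t + 1) := by rw [pow_succ]; ring

/-- **Prime supply** (M–A §2.2: "by the Prime Number Theorem, the primes `p₀, …, pₙ` are also
bounded by such a polynomial … we can afford to sieve for the primes"; here from the tree's crude
Chebyshev bound `2ᵗ ≤ t·π(2ᵗ) + t + 1`, `CRRFacts.two_pow_le_mul_primeCounting`): as soon as
`64 (m + 2)² ≤ 2ᵗ` there are at least `m + 2` primes `≤ 2ᵗ`.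
[cite: MandersAdleman1978, §2.2 (analysis of computation time)] -/
theorem le_primeCounting_two_pow {m t : ℕ} (h : 64 * (m + 2) ^ 2 ≤ 2 ^ t) : m + 2 ≤ Nat.primeCounting (2 ^ t) := by
  by_contra hlt
  push Not at hlt
  have h1 := two_pow_le_mul_primeCounting t
  set u := m + 2 with hu
  have h2 : 2 ^ t ≤ (t + 1) * u := by
    calc 2 ^ t ≤ t * Nat.primeCounting (2 ^ t) + t + 1 := h1
      _ ≤ t * (m + 1) + t + 1 := by have := Nat.mul_le_mul_left t (Nat.le_of_lt_succ hlt); omega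
      _ = t * u + 1 := by rw [hu]; ring
      _ ≤ t * u + u := by omega
      _ = (t + 1) * u := by ring
  -- `64 u² ≤ (t+1) u`, so `64 u ≤ t + 1`
  have h3 : 64 * u ≤ t + 1 := by
    have : 64 * u * u ≤ (t + 1) * u := by rw [mul_assoc, ← pow_two]; exact h.trans h2
    exact Nat.le_of_mul_le_mul_right this (by omega)
  have ht6 : 6 ≤ t := by omega
  -- `2ᵗ ≤ (t+1) u ≤ (t+1)² / 64 < (t+1)² ≤ 2ᵗ`
  have h4 : 64 * 2 ^ t ≤ (t + 1) ^ 2 := by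
    calc 64 * 2 ^ t ≤ 64 * ((t + 1) * u) := Nat.mul_le_mul_left _ h2
      _ = (t + 1) * (64 * u) := by ring
      _ ≤ (t + 1) * (t + 1) := Nat.mul_le_mul_left _ h3
      _ = (t + 1) ^ 2 := (pow_two _).symm
  have h5 := succ_sq_le_two_pow ht6
  have : 0 < 2 ^ t := pow_pos (by norm_num) t
  omega

/-- `2ᵗ` is not prime for `t ≠ 1`. [folklore] -/
theorem not_prime_two_pow {t : ℕ} (ht : t ≠ 1) : ¬ (2 ^ t).Prime := fun hp => by
  rcases Nat.eq_zero_or_pos t with rfl | hpos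
  · exact Nat.not_prime_one (by simpa using hp)
  · have h2 : 2 ∣ 2 ^ t := dvd_pow_self 2 hpos.ne'
    rcases (Nat.dvd_prime hp).1 h2 with h | h
    · norm_num at h
    · exact ht (Nat.pow_right_injective le_rfl (h.symm.trans (pow_one 2).symm))

/-- Prime supply in the strict form: `m + 2 ≤ π'(2ᵗ)` (primes `< 2ᵗ`) when `64 (m+2)² ≤ 2ᵗ`.
[cite: MandersAdleman1978, §2.2 (analysis of computation time)] -/
theorem le_primeCounting'_two_pow {m t : ℕ} (h : 64 * (m + 2) ^ 2 ≤ 2 ^ t) : m + 2 ≤ Nat.primeCounting' (2 ^ t) := by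
  have h1 := le_primeCounting_two_pow h
  have ht : t ≠ 1 := by rintro rfl; norm_num at h; nlinarith
  rw [Nat.primeCounting, Nat.primeCounting', Nat.count_succ] at h1
  rw [Nat.primeCounting']
  simpa [not_prime_two_pow ht] using h1

end MandersAdleman

end Literature.Computability.Complexity
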